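import Mathlib
import Literature.MathematicalPhysics.QuantumFieldTheory.Balaban1983to89.T3UnitScaleTilt
import HarnessLib

/-!
# Crux `FluctuationComparisonRegPrIntL` (stmt-QuantumFields-20520), LINE «fixed-height floor» (ym-r3-idea-1 g14) —
registered stub `stub_windowLogRatioTV` (S/M)

Two probability laws `μ = Haar·ρ`, `μ' = Haar·ρ'` on the height-`j` gauge fields whose densities are positive on the
small-field window `{PlaqSmall θ}`, whose log-ratio is constant up to `τ` on the window, and whose window complements
have mass `≤ η`, are `ε`-close on every measurable set once `τ, η ≤ δ(ε)` (here `δ = min (1/8) (ε/10)`).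

Proof: on a measurable `B ⊆ window`, `e^{-(τ-c)} μ' B ≤ μ B ≤ e^{c+τ} μ' B` (integrate the pointwise density bounds);
applied to the window itself and combined with the two normalisations this gives `c + τ ≤ 2τ - log (1-η)` and
`τ - c ≤ 2τ - log (1-η)`, with `-log (1-η) ≤ 2η`; hence on `A ∩ window` the two masses differ by at most
`e^{2τ+2η} - 1 ≤ 4τ + 4η` (`Real.abs_exp_sub_one_le`), and the two pieces `A \ window` contribute `≤ η` each.

This is the statement of the registered stub `stub_windowLogRatioTV` of the skeleton
`Summits/QuantumFields/YangMills/Cruxes/FluctuationComparisonRegPrIntL/Lines/fixed_height_floor.lean`.  Pure measure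
theory; no summit, rung, organ or crux is proved by this file; `YM3TorusSU2` and the Yang–Mills mass gap are NOT proved.
-/

set_option autoImplicit false

open MeasureTheory Set
open Literature.MathematicalPhysics.QuantumFieldTheory.Balaban1983to89 T3ContinuumYM3Torus
  T4Continuum T3UnitScaleTilt

namespace Summit.QuantumFields.YangMills.Theorems.FluctuationComparisonRegPrIntL.FixedHeightFloor

/-- Integrating a pointwise density comparison `ρ ≤ e^s ρ'` over a measurable set. -/
theorem measureReal_le_exp_mul_of_density_le {X : Type*} [MeasurableSpace X] (ν μ μ' : Measure X)
    [IsFiniteMeasure μ'] (ρ ρ' : X → ℝ) (hρ' : Measurable ρ')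
    (hμ : μ = ν.withDensity (fun x => ENNReal.ofReal (ρ x)))
    (hμ' : μ' = ν.withDensity (fun x => ENNReal.ofReal (ρ' x)))
    {B : Set X} (hB : MeasurableSet B) (s : ℝ) (hle : ∀ x ∈ B, ρ x ≤ Real.exp s * ρ' x) :
    μ.real B ≤ Real.exp s * μ'.real B := by
  have hpt : (fun x => ENNReal.ofReal (Real.exp s * ρ' x)) =
      fun x => ENNReal.ofReal (Real.exp s) * ENNReal.ofReal (ρ' x) := by
    funext x; exact ENNReal.ofReal_mul (Real.exp_pos s).le
  have h1 : μ B ≤ ENNReal.ofReal (Real.exp s) * μ' B := by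
    rw [hμ, hμ', withDensity_apply _ hB, withDensity_apply _ hB]
    calc ∫⁻ x in B, ENNReal.ofReal (ρ x) ∂ν
        ≤ ∫⁻ x in B, ENNReal.ofReal (Real.exp s * ρ' x) ∂ν :=
          setLIntegral_mono' hB (fun x hx => ENNReal.ofReal_le_ofReal (hle x hx))
      _ = ENNReal.ofReal (Real.exp s) * ∫⁻ x in B, ENNReal.ofReal (ρ' x) ∂ν := by
          rw [hpt, lintegral_const_mul _ hρ'.ennreal_ofReal]
  have hfin : μ' B ≠ ⊤ := measure_ne_top _ _
  calc μ.real B = (μ B).toReal := rfl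
    _ ≤ (ENNReal.ofReal (Real.exp s) * μ' B).toReal :=
        ENNReal.toReal_mono (ENNReal.mul_ne_top ENNReal.ofReal_ne_top hfin) h1
    _ = Real.exp s * μ'.real B := by
        rw [ENNReal.toReal_mul, ENNReal.toReal_ofReal (Real.exp_pos s).le]; rfl

/-- VERBATIM copy of `WindowLogRatioTV` from the skeleton `Lines/fixed_height_floor.lean`. -/
def WindowLogRatioTV : Prop :=
  ∀ ε : ℝ, 0 < ε → ∃ δ : ℝ, 0 < δ ∧ ∀ (F : T3Family) (j : ℕ) (θ : ℝ)
    (μ μ' : Measure (GaugeField (F.P j) 0 (Matrix.specialUnitaryGroup (Fin 2) ℂ)))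
    (ρ ρ' : GaugeField (F.P j) 0 (Matrix.specialUnitaryGroup (Fin 2) ℂ) → ℝ),
    IsProbabilityMeasure μ → IsProbabilityMeasure μ' → Measurable ρ → Measurable ρ' →
    (∀ U, 0 ≤ ρ U) → (∀ U, 0 ≤ ρ' U) → (∀ U, PlaqSmall θ U → 0 < ρ U ∧ 0 < ρ' U) →
    μ = (fieldMeasure _ _ _).withDensity (fun U => ENNReal.ofReal (ρ U)) →
    μ' = (fieldMeasure _ _ _).withDensity (fun U => ENNReal.ofReal (ρ' U)) →
    ∀ (c τ η : ℝ), 0 ≤ τ → τ ≤ δ → 0 ≤ η → η ≤ δ →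
    (∀ U, PlaqSmall θ U → |Real.log (ρ U) - Real.log (ρ' U) - c| ≤ τ) →
    μ {U | ¬ PlaqSmall θ U} ≤ ENNReal.ofReal η → μ' {U | ¬ PlaqSmall θ U} ≤ ENNReal.ofReal η →
    ∀ A : Set (GaugeField (F.P j) 0 (Matrix.specialUnitaryGroup (Fin 2) ℂ)), MeasurableSet A → |μ.real A - μ'.real A| ≤ ε

/-- The registered stub `stub_windowLogRatioTV` of `Lines/fixed_height_floor.lean`, proved. -/
theorem stub_windowLogRatioTV : WindowLogRatioTV := by
  intro ε hε
  refine ⟨min (1/8) (ε/10), by positivity, ?_⟩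
  intro F j θ μ μ' ρ ρ' hμP hμ'P hρm hρ'm hρ0 hρ'0 hpos hμ hμ' c τ η hτ0 hτδ hη0 hηδ hlog hW hW' A hA
  have hδ8 : min (1/8 : ℝ) (ε/10) ≤ 1/8 := min_le_left _ _
  have hδε : min (1/8 : ℝ) (ε/10) ≤ ε/10 := min_le_right _ _
  have hτ8 : τ ≤ 1/8 := hτδ.trans hδ8
  have hη8 : η ≤ 1/8 := hηδ.trans hδ8
  have hτε : τ ≤ ε/10 := hτδ.trans hδε
  have hηε : η ≤ ε/10 := hηδ.trans hδε
  set W : Set (GaugeField (F.P j) 0 (Matrix.specialUnitaryGroup (Fin 2) ℂ)) := {U | PlaqSmall θ U} with hWdef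
  have hWm : MeasurableSet W := measurableSet_plaqSmall θ
  have hcW : Wᶜ = {U | ¬ PlaqSmall θ U} := by rw [hWdef, Set.compl_setOf]
  -- pointwise density comparisons on the window
  have hup : ∀ U ∈ W, ρ U ≤ Real.exp (c + τ) * ρ' U := by
    intro U hU
    obtain ⟨h1, h2⟩ := hpos U hU
    have hl := (abs_le.mp (hlog U hU)).2
    calc ρ U = Real.exp (Real.log (ρ U)) := (Real.exp_log h1).symm
      _ ≤ Real.exp (Real.log (ρ' U) + (c + τ)) := Real.exp_le_exp.mpr (by linarith)
      _ = Real.exp (c + τ) * ρ' U := by rw [Real.exp_add, Real.exp_log h2, mul_comm]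
  have hlo : ∀ U ∈ W, ρ' U ≤ Real.exp (τ - c) * ρ U := by
    intro U hU
    obtain ⟨h1, h2⟩ := hpos U hU
    have hl := (abs_le.mp (hlog U hU)).1
    calc ρ' U = Real.exp (Real.log (ρ' U)) := (Real.exp_log h2).symm
      _ ≤ Real.exp (Real.log (ρ U) + (τ - c)) := Real.exp_le_exp.mpr (by linarith)
      _ = Real.exp (τ - c) * ρ U := by rw [Real.exp_add, Real.exp_log h1, mul_comm]
  -- integrated comparisons on `A ∩ W` and on `W`
  have hBm : MeasurableSet (A ∩ W) := hA.inter hWm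
  have hB1 : μ.real (A ∩ W) ≤ Real.exp (c + τ) * μ'.real (A ∩ W) :=
    measureReal_le_exp_mul_of_density_le _ μ μ' ρ ρ' hρ'm hμ hμ' hBm (c + τ) (fun U hU => hup U hU.2)
  have hB2 : μ'.real (A ∩ W) ≤ Real.exp (τ - c) * μ.real (A ∩ W) :=
    measureReal_le_exp_mul_of_density_le _ μ' μ ρ' ρ hρm hμ' hμ hBm (τ - c) (fun U hU => hlo U hU.2)
  have hW1 : μ.real W ≤ Real.exp (c + τ) * μ'.real W :=
    measureReal_le_exp_mul_of_density_le _ μ μ' ρ ρ' hρ'm hμ hμ' hWm (c + τ) hup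
  have hW2 : μ'.real W ≤ Real.exp (τ - c) * μ.real W :=
    measureReal_le_exp_mul_of_density_le _ μ' μ ρ' ρ hρm hμ' hμ hWm (τ - c) hlo
  -- tails and normalisations in real form
  have hWc : μ.real Wᶜ ≤ η := by
    rw [hcW]; exact ENNReal.toReal_le_of_le_ofReal hη0 hW
  have hWc' : μ'.real Wᶜ ≤ η := by
    rw [hcW]; exact ENNReal.toReal_le_of_le_ofReal hη0 hW'
  have hsum : μ.real W + μ.real Wᶜ = 1 := by rw [measureReal_add_measureReal_compl hWm, probReal_univ]
  have hsum' : μ'.real W + μ'.real Wᶜ = 1 := by rw [measureReal_add_measureReal_compl hWm, probReal_univ]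
  have hWnn : 0 ≤ μ.real Wᶜ := measureReal_nonneg
  have hWnn' : 0 ≤ μ'.real Wᶜ := measureReal_nonneg
  have hBnn : 0 ≤ μ.real (A ∩ W) := measureReal_nonneg
  have hBnn' : 0 ≤ μ'.real (A ∩ W) := measureReal_nonneg
  have hBle : μ.real (A ∩ W) ≤ 1 := by
    have := measureReal_mono (μ := μ) (Set.inter_subset_right : A ∩ W ⊆ W); linarith
  have hBle' : μ'.real (A ∩ W) ≤ 1 := by
    have := measureReal_mono (μ := μ') (Set.inter_subset_right : A ∩ W ⊆ W); linarith
  -- the size of the constant `c`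
  have h1η : 0 < 1 - η := by linarith
  have hL : -Real.log (1 - η) ≤ 2 * η := by
    have h := Real.log_le_sub_one_of_pos (inv_pos.mpr h1η)
    rw [Real.log_inv] at h
    have h2 : (1 - η)⁻¹ - 1 ≤ 2 * η := by
      rw [sub_le_iff_le_add, inv_le_iff_one_le_mul₀ h1η]
      nlinarith
    linarith
  have hexp1 : 1 - η ≤ Real.exp (c + τ) := by
    have hpos1 : 0 ≤ Real.exp (c + τ) := (Real.exp_pos _).le
    have : μ'.real W ≤ 1 := by linarith
    nlinarith [hW1]
  have hexp2 : 1 - η ≤ Real.exp (τ - c) := by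
    have hpos1 : 0 ≤ Real.exp (τ - c) := (Real.exp_pos _).le
    have : μ.real W ≤ 1 := by linarith
    nlinarith [hW2]
  have hc1 : Real.log (1 - η) ≤ c + τ := (Real.log_le_iff_le_exp h1η).mpr hexp1
  have hc2 : Real.log (1 - η) ≤ τ - c := (Real.log_le_iff_le_exp h1η).mpr hexp2
  -- the main term on `A ∩ W`
  set s : ℝ := 2 * τ + 2 * η with hsdef
  have hs0 : 0 ≤ s := by positivity
  have hs1 : |s| ≤ 1 := by rw [abs_of_nonneg hs0]; linarith
  have hcs1 : c + τ ≤ s := by linarith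
  have hcs2 : τ - c ≤ s := by linarith
  have hes : Real.exp s - 1 ≤ 2 * s := by
    have h := Real.abs_exp_sub_one_le hs1
    rw [abs_of_nonneg hs0] at h
    exact (le_abs_self _).trans h
  have hes0 : 0 ≤ Real.exp s - 1 := by linarith [Real.add_one_le_exp s]
  have hd1 : μ.real (A ∩ W) - μ'.real (A ∩ W) ≤ Real.exp s - 1 := by
    have h1 : Real.exp (c + τ) * μ'.real (A ∩ W) ≤ Real.exp s * μ'.real (A ∩ W) :=
      mul_le_mul_of_nonneg_right (Real.exp_le_exp.mpr hcs1) hBnn'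
    have h2 : Real.exp s * μ'.real (A ∩ W) - μ'.real (A ∩ W) = (Real.exp s - 1) * μ'.real (A ∩ W) := by ring
    have h3 : (Real.exp s - 1) * μ'.real (A ∩ W) ≤ Real.exp s - 1 := mul_le_of_le_one_right hes0 hBle'
    linarith
  have hd2 : μ'.real (A ∩ W) - μ.real (A ∩ W) ≤ Real.exp s - 1 := by
    have h1 : Real.exp (τ - c) * μ.real (A ∩ W) ≤ Real.exp s * μ.real (A ∩ W) :=
      mul_le_mul_of_nonneg_right (Real.exp_le_exp.mpr hcs2) hBnn
    have h2 : Real.exp s * μ.real (A ∩ W) - μ.real (A ∩ W) = (Real.exp s - 1) * μ.real (A ∩ W) := by ring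
    have h3 : (Real.exp s - 1) * μ.real (A ∩ W) ≤ Real.exp s - 1 := mul_le_of_le_one_right hes0 hBle
    linarith
  have hdB : |μ.real (A ∩ W) - μ'.real (A ∩ W)| ≤ 4 * τ + 4 * η := by
    rw [abs_le]; constructor <;> linarith
  -- the pieces off the window
  have hAd : μ.real (A \ W) ≤ η :=
    (measureReal_mono (μ := μ) (Set.sdiff_subset_compl A W)).trans hWc
  have hAd' : μ'.real (A \ W) ≤ η :=
    (measureReal_mono (μ := μ') (Set.sdiff_subset_compl A W)).trans hWc'
  have hAdnn : 0 ≤ μ.real (A \ W) := measureReal_nonneg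
  have hAdnn' : 0 ≤ μ'.real (A \ W) := measureReal_nonneg
  have hAdec : μ.real A = μ.real (A ∩ W) + μ.real (A \ W) := (measureReal_inter_add_sdiff hWm (μ := μ)).symm
  have hAdec' : μ'.real A = μ'.real (A ∩ W) + μ'.real (A \ W) := (measureReal_inter_add_sdiff hWm (μ := μ')).symm
  rw [hAdec, hAdec', abs_le]
  rw [abs_le] at hdB
  constructor <;> linarith [hdB.1, hdB.2]

end Summit.QuantumFields.YangMills.Theorems.FluctuationComparisonRegPrIntL.FixedHeightFloor
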